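import Literature.Combinatorics.Optimization.SymmetricSDPMatching
import Literature.Combinatorics.Optimization.PatternMatrixPsdRank
import Literature.Computation.Certificates.SDPFaceReduction
import Literature.Analysis.Convex.ConeLift
import HarnessLib

/-!
# The factorization theorem for SDP formulations (Braun–Pokutta–Zink; Yannakakis for SDPs)

Braun–Pokutta–Zink's factorization theorem for `(C̃, S̃)`-approximate SDP formulations of a maximization
problem `𝒫 = (𝒮, ℱ)` (Definition 2.2 of Braun–Brown-Cohen–Huq–Pokutta–Raghavendra–Roy–Weitz–Zink, typed in
the tree as `Literature.Combinatorics.Optimization.SDPFormulation`), non-symmetric core — the "standard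
strong duality argument" quoted in [cite: BraunEtAl2016, Lemma 2.3 (p. 5)]: "for every `f ∈ ℱ` with
`max f ≤ S̃(f)`, there is a `U^f ∈ 𝕊^d_+` and `μ_f ≥ 0` such that for all `s ∈ 𝒮`,
`C̃(f) − f(s) = Tr[U^f X^s] + μ_f`" [cite: BraunPokuttaZink2015, Thm. (SDP factorization)]. For exact
formulations of polytopes this is Yannakakis' factorization theorem for SDPs, direction "psd lift of size
`d` ⇒ psd factorization of the slack matrix" [cite: BrietDadushPokutta2014, Thm. 4 (p. 5)]
[cite: GouveiaParriloThomas2013, Thm. 2.4] [cite: FawziSaundersonParrilo2013, Thm. 4 (p. 10)].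

PROVED here (no named facts), on top of the tree's Slater-free SDP certificate
`Literature.Computation.Certificates.SDPFaceReduction.exists_posSemidef_certificate_of_lowerBound`
(facial reduction + strong duality):

* `SDPFormulation.exists_posSemidef_slack` — the displayed statement, for every sound `f`;
* `SDPFormulation.hasPsdFactorization_slack` — hence the slack matrix `(f, s) ↦ C̃(f) − f(s)` (rows: the
  sound objectives) has a psd factorization of size `d + 1` (the `+1` carries the constants `μ_f`, exactly as
  the `+1` of the tree's LP version `Literature.Barriers.PneNP.HasEFOfSize.exists_nonneg_factorisation`).

The linear maps `𝒜 : 𝕊^d → ℝ^k` and `w^f` of Definition 2.2 are arbitrary linear maps on `d × d` real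
matrices; they are represented against the trace pairing (`Y ↦ tr(G Y)`) and symmetrised, which is
harmless on the psd (hence symmetric) feasible matrices. NOT here: the symmetric refinement (Lemma 2.3's
`G`-invariant family of `C(d+1,2)` functions `√X`), and the converse direction factorization ⇒ formulation.
-/

noncomputable section

open Matrix Finset

namespace Literature.Combinatorics.Optimization

open Literature.Computation.Certificates.SemidefiniteComplementarity (frob IsPrimalFeasible)
open Literature.Computation.Certificates.SDPFaceReduction (exists_posSemidef_certificate_of_lowerBound)
open Literature.Analysis.Convex (selMatrix padMatrix padMatrix_apply posSemidef_padMatrix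
  selMatrix_transpose_mul_self selMatrix_transpose_mul_of_ne)

variable {σ φ : Type*} {d : ℕ}

/-! ### Linear functionals on matrices against the trace pairing -/

/-- Riesz for the trace pairing: every linear functional on `d × d` real matrices is `Y ↦ tr(G Y)`
(`G_{ab} = ℓ(E_{ba})`). [folklore] -/
private theorem exists_eq_trace_mul (ℓ : Matrix (Fin d) (Fin d) ℝ →ₗ[ℝ] ℝ) :
    ∃ G : Matrix (Fin d) (Fin d) ℝ, ∀ Y, ℓ Y = (G * Y).trace := by
  classical
  refine ⟨Matrix.of fun a b => ℓ (single b a 1), fun Y => ?_⟩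
  conv_lhs => rw [matrix_eq_sum_single Y]
  simp only [map_sum]
  have hsingle : ∀ i j, ℓ (single i j (Y i j)) = Y i j * ℓ (single i j 1) := by
    intro i j
    rw [← smul_eq_mul, ← map_smul, smul_single, smul_eq_mul, mul_one]
  simp only [hsingle, trace, diag_apply, mul_apply, of_apply]
  rw [sum_comm]
  exact sum_congr rfl fun a _ => sum_congr rfl fun b _ => mul_comm _ _

/-- Symmetrised representative: on SYMMETRIC matrices `tr(G Y) = tr(½(G + Gᵀ) Y)`, and `½(G + Gᵀ)` is
Hermitian. [folklore] -/
private theorem exists_isHermitian_eq_trace_mul (ℓ : Matrix (Fin d) (Fin d) ℝ →ₗ[ℝ] ℝ) :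
    ∃ G : Matrix (Fin d) (Fin d) ℝ, G.IsHermitian ∧ ∀ Y, Yᵀ = Y → ℓ Y = (G * Y).trace := by
  obtain ⟨G, hG⟩ := exists_eq_trace_mul ℓ
  refine ⟨(2 : ℝ)⁻¹ • (G + Gᵀ), ?_, fun Y hY => ?_⟩
  · rw [IsHermitian, conjTranspose_eq_transpose_of_trivial, transpose_smul, transpose_add,
      transpose_transpose, add_comm]
  · have hT : (Gᵀ * Y).trace = (G * Y).trace := by
      rw [← trace_transpose, transpose_mul, transpose_transpose, hY, trace_mul_comm]
    rw [hG, Matrix.smul_mul, Matrix.add_mul, trace_smul, trace_add, hT, smul_eq_mul]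
    ring

/-! ### The factorization theorem -/

/-- **Factorization theorem for SDP formulations** (Braun–Pokutta–Zink; the duality step of
Braun et al. Lemma 2.3): for a `(C̃, S̃)`-approximate SDP formulation of size `d` and every sound objective
`f` (`max f ≤ S̃(f)`) there are `U^f ⪰ 0` and `μ_f ≥ 0` with `C̃(f) − f(s) = tr(U^f X^s) + μ_f` for all
feasible solutions `s`. [cite: BraunEtAl2016, Lemma 2.3 (p. 5)] [cite: BraunPokuttaZink2015, Thm. (SDP factorization)] -/
theorem SDPFormulation.exists_posSemidef_slack {P : MaxProblem σ φ} (E : SDPFormulation P d) {f : φ}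
    (hf : P.Sound f) :
    ∃ U : Matrix (Fin d) (Fin d) ℝ, U.PosSemidef ∧ ∃ μ : ℝ, 0 ≤ μ ∧
      ∀ s, P.C f - P.val f s = (U * E.X s).trace + μ := by
  classical
  rcases isEmpty_or_nonempty σ with hσ | ⟨⟨s₀⟩⟩
  · exact ⟨0, PosSemidef.zero, 0, le_rfl, fun s => (hσ.false s).elim⟩
  -- represent `𝒜` and `w^f` against the trace pairing, symmetrised
  choose G hGh hG using fun i : Fin E.k => exists_isHermitian_eq_trace_mul ((LinearMap.proj i).comp E.A)
  obtain ⟨W, hWh, hW⟩ := exists_isHermitian_eq_trace_mul (E.w f)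
  have hGA : ∀ Y : Matrix (Fin d) (Fin d) ℝ, Yᵀ = Y → ∀ i, (G i * Y).trace = E.A Y i :=
    fun Y hY i => (hG i Y hY).symm
  have htr : ∀ {Y : Matrix (Fin d) (Fin d) ℝ}, Y.PosSemidef → Yᵀ = Y := fun hY => by
    have h := hY.1.eq
    rwa [conjTranspose_eq_transpose_of_trivial] at h
  -- the feasible set of the tree's (SDP-P) with data `(G, b)` is `{Y ⪰ 0 : 𝒜 Y = b}`
  have hfeas : ∀ Y, IsPrimalFeasible G E.b Y ↔ Y.PosSemidef ∧ E.A Y = E.b := by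
    intro Y
    constructor
    · rintro ⟨hY, hYb⟩
      exact ⟨hY, funext fun i => by rw [← hGA Y (htr hY) i]; exact hYb i⟩
    · rintro ⟨hY, hYb⟩
      exact ⟨hY, fun i => by unfold frob; rw [hGA Y (htr hY) i, hYb]⟩
  -- lower bound `E.c f − C̃(f) ≤ tr((−W) Y)` on the feasible set, from `achieves`
  have hne : ∃ Y, IsPrimalFeasible G E.b Y := ⟨E.X s₀, (hfeas _).2 ⟨E.posSemidef_X s₀, E.A_X s₀⟩⟩
  have hlb : ∀ Y, IsPrimalFeasible G E.b Y → E.c f - P.C f ≤ frob (-W) Y := by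
    intro Y hY
    obtain ⟨hYpsd, hYb⟩ := (hfeas Y).1 hY
    have h := E.achieves f hf Y hYpsd hYb
    unfold frob
    rw [Matrix.neg_mul, trace_neg, ← hW Y (htr hYpsd)]
    linarith
  have hWneg : (-W).IsHermitian := hWh.neg
  obtain ⟨U, hU, μ, hμ, hcert⟩ := exists_posSemidef_certificate_of_lowerBound hGh hWneg hne hlb
  refine ⟨U, hU, μ, hμ, fun s => ?_⟩
  have hs := hcert (E.X s) ((hfeas _).2 ⟨E.posSemidef_X s, E.A_X s⟩)
  have hex := E.exact f hf s
  unfold frob at hs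
  rw [Matrix.neg_mul, trace_neg, ← hW (E.X s) (htr (E.posSemidef_X s))] at hs
  linarith

/-! ### The slack matrix has a psd factorization of size `d + 1` -/

/-- Block-diagonal embedding `diag(U, μ)` of sizes `d` and `1` into size `d + 1` (via the tree's
zero-padding maps) is psd for `U ⪰ 0`, `μ ≥ 0`. [folklore] -/
private theorem posSemidef_blockDiag {U : Matrix (Fin d) (Fin d) ℝ} {μ : ℝ} (hU : U.PosSemidef)
    (hμ : 0 ≤ μ) :
    (padMatrix Fin.castSucc U + padMatrix (fun _ : Fin 1 => Fin.last d) (μ • 1)).PosSemidef :=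
  (posSemidef_padMatrix hU).add (posSemidef_padMatrix (PosSemidef.one.smul hμ))

/-- `tr(diag(U, μ) · diag(X, ν)) = tr(U X) + μ ν`. [folklore] -/
private theorem trace_blockDiag_mul (U X : Matrix (Fin d) (Fin d) ℝ) (μ ν : ℝ) :
    ((padMatrix Fin.castSucc U + padMatrix (fun _ : Fin 1 => Fin.last d) (μ • 1)) *
      (padMatrix Fin.castSucc X + padMatrix (fun _ : Fin 1 => Fin.last d) (ν • 1))).trace
      = (U * X).trace + μ * ν := by
  set e : Fin d → Fin (d + 1) := Fin.castSucc with he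
  set g : Fin 1 → Fin (d + 1) := fun _ => Fin.last d with hg
  set M1 : Matrix (Fin 1) (Fin 1) ℝ := μ • 1 with hM1
  set N1 : Matrix (Fin 1) (Fin 1) ℝ := ν • 1 with hN1
  have heinj : Function.Injective e := Fin.castSucc_injective d
  have hginj : Function.Injective g := fun a b _ => Subsingleton.elim a b
  have hne : ∀ a b, e a ≠ g b := fun a _ => (Fin.castSucc_lt_last a).ne
  have h1 : (selMatrix e)ᵀ * selMatrix e = 1 := selMatrix_transpose_mul_self heinj
  have h2 : (selMatrix g)ᵀ * selMatrix g = 1 := selMatrix_transpose_mul_self hginj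
  have h12 : (selMatrix e)ᵀ * selMatrix g = 0 := selMatrix_transpose_mul_of_ne hne
  have h21 : (selMatrix g)ᵀ * selMatrix e = 0 :=
    selMatrix_transpose_mul_of_ne fun b a => (hne a b).symm
  simp only [padMatrix_apply, Matrix.add_mul, Matrix.mul_add, trace_add]
  have t1 : (selMatrix e * U * (selMatrix e)ᵀ * (selMatrix e * X * (selMatrix e)ᵀ)).trace
      = (U * X).trace := by
    calc (selMatrix e * U * (selMatrix e)ᵀ * (selMatrix e * X * (selMatrix e)ᵀ)).trace
        = (selMatrix e * (U * ((selMatrix e)ᵀ * selMatrix e) * X) * (selMatrix e)ᵀ).trace := by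
          simp only [Matrix.mul_assoc]
      _ = ((selMatrix e)ᵀ * selMatrix e * (U * ((selMatrix e)ᵀ * selMatrix e) * X)).trace :=
          trace_mul_cycle _ _ _
      _ = (U * X).trace := by rw [h1, Matrix.one_mul, Matrix.mul_one]
  have t2 : (selMatrix e * U * (selMatrix e)ᵀ * (selMatrix g * N1 * (selMatrix g)ᵀ)).trace = 0 := by
    calc (selMatrix e * U * (selMatrix e)ᵀ * (selMatrix g * N1 * (selMatrix g)ᵀ)).trace
        = (selMatrix e * U * ((selMatrix e)ᵀ * selMatrix g) * N1 * (selMatrix g)ᵀ).trace := by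
          simp only [Matrix.mul_assoc]
      _ = 0 := by rw [h12]; simp
  have t3 : (selMatrix g * M1 * (selMatrix g)ᵀ * (selMatrix e * X * (selMatrix e)ᵀ)).trace = 0 := by
    calc (selMatrix g * M1 * (selMatrix g)ᵀ * (selMatrix e * X * (selMatrix e)ᵀ)).trace
        = (selMatrix g * M1 * ((selMatrix g)ᵀ * selMatrix e) * X * (selMatrix e)ᵀ).trace := by
          simp only [Matrix.mul_assoc]
      _ = 0 := by rw [h21]; simp
  have t4 : (selMatrix g * M1 * (selMatrix g)ᵀ * (selMatrix g * N1 * (selMatrix g)ᵀ)).trace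
      = μ * ν := by
    calc (selMatrix g * M1 * (selMatrix g)ᵀ * (selMatrix g * N1 * (selMatrix g)ᵀ)).trace
        = (selMatrix g * (M1 * ((selMatrix g)ᵀ * selMatrix g) * N1) * (selMatrix g)ᵀ).trace := by
          simp only [Matrix.mul_assoc]
      _ = ((selMatrix g)ᵀ * selMatrix g * (M1 * ((selMatrix g)ᵀ * selMatrix g) * N1)).trace :=
          trace_mul_cycle _ _ _
      _ = μ * ν := by
          rw [h2, Matrix.one_mul, Matrix.mul_one, hM1, hN1, Matrix.smul_mul, Matrix.one_mul, smul_smul,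
            trace_smul, trace_one, Fintype.card_fin, smul_eq_mul, Nat.cast_one, mul_one]
  rw [t1, t2, t3, t4]; ring

/-- **Yannakakis' factorization theorem for SDPs, direction formulation ⇒ factorization**: an SDP
formulation of size `d` of `𝒫` gives a psd factorization of size `d + 1` of the slack matrix
`(f, s) ↦ C̃(f) − f(s)` over the sound objectives (`A_f = diag(U^f, μ_f)`, `B_s = diag(X^s, 1)`; the
extra coordinate carries the constants, as in the tree's LP version
`Literature.Barriers.PneNP.HasEFOfSize.exists_nonneg_factorisation`).
[cite: BraunPokuttaZink2015, Thm. (SDP factorization)] [cite: BrietDadushPokutta2014, Thm. 4 (p. 5)]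
[cite: GouveiaParriloThomas2013, Thm. 2.4] -/
theorem SDPFormulation.hasPsdFactorization_slack {P : MaxProblem σ φ} (E : SDPFormulation P d) :
    HasPsdFactorization (fun (f : {f : φ // P.Sound f}) (s : σ) => P.C f.1 - P.val f.1 s) (d + 1) := by
  classical
  choose U hU μ hμ hslack using fun f : {f : φ // P.Sound f} => E.exists_posSemidef_slack f.2
  refine ⟨fun f => padMatrix Fin.castSucc (U f) + padMatrix (fun _ : Fin 1 => Fin.last d) (μ f • 1),
    fun s => padMatrix Fin.castSucc (E.X s) + padMatrix (fun _ : Fin 1 => Fin.last d) ((1 : ℝ) • 1),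
    fun f => posSemidef_blockDiag (hU f) (hμ f),
    fun s => posSemidef_blockDiag (E.posSemidef_X s) zero_le_one, fun f s => ?_⟩
  rw [trace_blockDiag_mul, mul_one]
  exact hslack f s

end Literature.Combinatorics.Optimization

end
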